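import Mathlib
import Literature.Combinatorics.Optimization.FarkasLemma
import HarnessLib

/-!
# Sign-degree (threshold degree) of a Boolean predicate and Guruswami–Lyu–Wang's «(d, δ)-simple»
# functions: a degree-`d` sign-representation makes a predicate `(d, δ)-simple`

Two printed notions for a Boolean predicate `P` on `k` bits, in the `±1` reading `b ↦ (−1)^b`:

* **sign-degree ≤ d** (`SignDegLE d P`; the STRONG DEGREE / threshold degree of Aspnes–Beigel–Furst–
  Rudich, Minsky–Papert's "order" of a perceptron): some rational multilinear polynomial supported on
  sets of size `≤ d` has the sign of `P`, strictly, at every point of the cube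
  [Aspnes–Beigel–Furst–Rudich 1994, §2 (strong representation / strong degree)];
* **(d, δ)-simple** (`IsSimple d δ P`; Guruswami–Lyu–Wang's simplicity measure behind their hitting
  sets for range avoidance): under EVERY probability distribution `φ` on the cube some character `χ_S`,
  `|S| ≤ d`, has correlation `|E_φ[P·χ_S]| ≥ δ` with `P` [Guruswami–Lyu–Wang 2025, Def. 32 — stated there
  for `f : {−1,1}ⁿ → {−1,1}` and distributions on `{−1,1}ⁿ`; for the table of a `k`-local output the
  induced distribution on the `k` read bits is what matters, so the notion is recorded on the `k`-cube].

**Theorem** (`exists_isSimple_of_signDegLE`, the elementary direction of the LP duality between the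
two): if `P·g ≥ τ > 0` pointwise for `g = Σ_{|S|≤d} c_S χ_S`, then under any `φ`,
`Σ_S c_S·E_φ[Pχ_S] = E_φ[P·g] ≥ τ`, so some `|S| ≤ d` has `|E_φ[Pχ_S]| ≥ τ/Σ_S|c_S|`: **sign-degree
`≤ d` ⇒ `(d, δ)`-simple with `δ = τ/‖c‖₁ > 0`**.  The converse («`(d, δ)`-simple for some `δ > 0` ⇒
sign-degree `≤ d`») is the other half of the same finite LP duality [Aspnes–Beigel–Furst–Rudich 1994,
§2: `P` has strong degree `> d` iff some distribution makes `P` orthogonal to every `χ_S`, `|S| ≤ d`];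
and IS proved below (`exists_fooling_of_not_signDegLE`, `signDegLE_iff_exists_isSimple`) from the tree's Farkas lemma `Literature.Combinatorics.Optimization.farkas` [Schrijver 1986, Cor. 7.1e].

Use: Guruswami–Lyu–Wang, Thm. 33, turns `(d, ε)`-simplicity of all output tables of `C : {±1}ⁿ →
{±1}^m` into an oblivious polynomial-size hitting set for `AVOID(C)` at stretch `m > (2/ε²)·n^d`; with
the theorem below this applies to every map whose tables have sign-degree `≤ d` (e.g. `d = 1`: linear
threshold tables, linear stretch).  Definitions are over `ℚ` (rational coefficients and weights), the
convention of the cell pnp-ideate's typed rungs (`SignDegLE` is character-identical to the planner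
sketch HOME/pnp-ideate-p3/r17/SketchN2.lean so that those statements can import it).

## References
* J. Aspnes, R. Beigel, M. Furst, S. Rudich, *The expressive power of voting polynomials*,
  Combinatorica 14 (1994) 135–148, §2.  bib `AspnesEtAl1994`.
* V. Guruswami, X. Lyu, X. Wang, *Range Avoidance for Low-Depth Circuits and Connections to
  Pseudorandomness*, ACM ToCT 17(2) (2025), Def. 32, Thm. 33 (§5.1), Lemmas 34–35.  bib `GuruswamiLyuWang2025`.
* M. Minsky, S. Papert, *Perceptrons*, MIT Press 1969 (the "order" of a predicate).
-/

namespace Literature.Computability.Complexity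

open Finset

variable {k : ℕ}

/-- The `±1` reading of a bit: `false ↦ 1`, `true ↦ −1` (`(−1)^b`). [folklore] -/
def bsgn (b : Bool) : ℚ := if b then -1 else 1

/-- `bsgn b` is `1` or `−1` (functions `{1,−1}ⁿ → {1,−1}` as in ABFR). [cite: AspnesEtAl1994, §2] -/
theorem bsgn_eq_or (b : Bool) : bsgn b = 1 ∨ bsgn b = -1 := by
  cases b <;> simp [bsgn]

/-- `|bsgn b| = 1`. [cite: AspnesEtAl1994, §2] -/
@[simp] theorem abs_bsgn (b : Bool) : |bsgn b| = 1 := by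
  cases b <;> simp [bsgn]

/-- The character `χ_S(u) = ∏_{i ∈ S} (−1)^{u_i}`. [folklore] -/
def chiQ (S : Finset (Fin k)) (u : Fin k → Bool) : ℚ := ∏ i ∈ S, bsgn (u i)

/-- `|χ_S(u)| = 1` (parity functions take values `±1`). [cite: AspnesEtAl1994, §2] -/
@[simp] theorem abs_chiQ (S : Finset (Fin k)) (u : Fin k → Bool) : |chiQ S u| = 1 := by
  unfold chiQ
  rw [Finset.abs_prod]
  simp

/-- **Sign-degree at most `d`** (strong degree / threshold degree / Minsky–Papert order): some rational
multilinear polynomial supported on sets of size `≤ d` STRICTLY sign-represents `P` at every point of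
the `k`-cube. [cite: AspnesEtAl1994, §2 (strong degree)] -/
def SignDegLE (d : ℕ) (P : (Fin k → Bool) → Bool) : Prop :=
  ∃ c : Finset (Fin k) → ℚ, (∀ S, d < S.card → c S = 0) ∧
    ∀ u : Fin k → Bool, 0 < bsgn (P u) * ∑ S : Finset (Fin k), c S * chiQ S u

/-- Sign-degree is monotone in `d`. [cite: AspnesEtAl1994, §2] -/
theorem SignDegLE.mono {d d' : ℕ} {P : (Fin k → Bool) → Bool} (h : SignDegLE d P) (hdd : d ≤ d') :
    SignDegLE d' P := by
  obtain ⟨c, hc, hpos⟩ := h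
  exact ⟨c, fun S hS => hc S (lt_of_le_of_lt hdd hS), hpos⟩

/-- A probability distribution on the `k`-cube with rational weights (the «any distribution φ over
{−1,1}ⁿ» of GLW Def. 32, restricted to the read bits). [cite: GuruswamiLyuWang2025, Def. 32] -/
structure CubeDist (k : ℕ) where
  /-- the weight of a point -/
  wt : (Fin k → Bool) → ℚ
  /-- weights are nonnegative -/
  nonneg : ∀ u, 0 ≤ wt u
  /-- weights sum to one -/
  total : ∑ u, wt u = 1

/-- The correlation `E_φ[P · χ_S]` (in the `±1` reading of `P`). [cite: GuruswamiLyuWang2025, Def. 32] -/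
def corr (φ : CubeDist k) (P : (Fin k → Bool) → Bool) (S : Finset (Fin k)) : ℚ :=
  ∑ u, φ.wt u * (bsgn (P u) * chiQ S u)

/-- **Guruswami–Lyu–Wang's `(d, δ)`-simple predicates** (Def. 32: "for any distribution `φ` … there is
a set `S` of size at most `d` such that the correlation between `χ_S` and `f` under `φ` is at least
`δ`"; the sign of the correlation is immaterial for their use, cf. their Lemma 34 "some `S` and some
`z`", so it is recorded in absolute value). [cite: GuruswamiLyuWang2025, Def. 32] -/
def IsSimple (d : ℕ) (δ : ℚ) (P : (Fin k → Bool) → Bool) : Prop :=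
  ∀ φ : CubeDist k, ∃ S : Finset (Fin k), S.card ≤ d ∧ δ ≤ |corr φ P S|

/-- Simplicity is monotone: larger `d` and smaller `δ` are weaker. [cite: GuruswamiLyuWang2025, Def. 32] -/
theorem IsSimple.mono {d d' : ℕ} {δ δ' : ℚ} {P : (Fin k → Bool) → Bool} (h : IsSimple d δ P)
    (hdd : d ≤ d') (hδ : δ' ≤ δ) : IsSimple d' δ' P := fun φ => by
  obtain ⟨S, hS, hc⟩ := h φ
  exact ⟨S, hS.trans hdd, hδ.trans hc⟩

/-- Averaging a pointwise lower bound against a probability distribution (the step «E_φ[P·g] ≥ τ»).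
[cite: GuruswamiLyuWang2025, Def. 32] -/
theorem CubeDist.le_expect (φ : CubeDist k) {v : (Fin k → Bool) → ℚ} {τ : ℚ} (hv : ∀ u, τ ≤ v u) :
    τ ≤ ∑ u, φ.wt u * v u := by
  calc τ = ∑ u, φ.wt u * τ := by rw [← Finset.sum_mul, φ.total, one_mul]
    _ ≤ ∑ u, φ.wt u * v u := Finset.sum_le_sum fun u _ => mul_le_mul_of_nonneg_left (hv u) (φ.nonneg u)

/-- **Sign-degree `≤ d` ⇒ `(d, δ)`-simple for some `δ > 0`** (the elementary direction of the LP
duality between strong degree and orthogonalising distributions: averaging `P·g ≥ τ` against `φ` gives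
`Σ_S c_S·E_φ[Pχ_S] ≥ τ`, so some `|S| ≤ d` carries correlation `≥ τ/‖c‖₁`).
[cite: AspnesEtAl1994, §2] [cite: GuruswamiLyuWang2025, Def. 32 with Lemmas 34–35] -/
theorem exists_isSimple_of_signDegLE {d : ℕ} {P : (Fin k → Bool) → Bool} (h : SignDegLE d P) :
    ∃ δ : ℚ, 0 < δ ∧ IsSimple d δ P := by
  classical
  obtain ⟨c, hc0, hpos⟩ := h
  set g : (Fin k → Bool) → ℚ := fun u => ∑ S : Finset (Fin k), c S * chiQ S u with hg
  -- the margin τ > 0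
  have hne : (Finset.univ : Finset (Fin k → Bool)).Nonempty := Finset.univ_nonempty
  set τ : ℚ := Finset.univ.inf' hne (fun u => bsgn (P u) * g u) with hτ
  have hτpos : 0 < τ := by
    rw [hτ, Finset.lt_inf'_iff]
    intro u _
    exact hpos u
  have hτle : ∀ u, τ ≤ bsgn (P u) * g u := fun u => Finset.inf'_le _ (Finset.mem_univ u)
  -- the ℓ₁ norm L > 0 of the coefficients
  set L : ℚ := ∑ S : Finset (Fin k), |c S| with hL
  have hLpos : 0 < L := by
    obtain ⟨u⟩ : Nonempty (Fin k → Bool) := ⟨fun _ => false⟩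
    have hgu : g u ≠ 0 := by
      intro h0
      have h1 := hτle u
      rw [h0, mul_zero] at h1
      exact absurd (lt_of_lt_of_le hτpos h1) (lt_irrefl 0)
    have : ∃ S, c S ≠ 0 := by
      by_contra hall
      push Not at hall
      apply hgu
      simp [hg, hall]
    obtain ⟨S, hS⟩ := this
    exact lt_of_lt_of_le (abs_pos.2 hS) (Finset.single_le_sum (fun T _ => abs_nonneg (c T)) (Finset.mem_univ S))
  refine ⟨τ / L, div_pos hτpos hLpos, fun φ => ?_⟩
  -- averaging: τ ≤ E_φ[P·g] = Σ_S c_S · corr_S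
  have hkey : τ ≤ ∑ S : Finset (Fin k), c S * corr φ P S := by
    have h1 : τ ≤ ∑ u, φ.wt u * (bsgn (P u) * g u) := φ.le_expect hτle
    have h2 : (∑ u, φ.wt u * (bsgn (P u) * g u)) = ∑ S : Finset (Fin k), c S * corr φ P S := by
      simp only [hg, corr, Finset.mul_sum]
      rw [Finset.sum_comm]
      refine Finset.sum_congr rfl fun S _ => Finset.sum_congr rfl fun u _ => ?_
      ring
    rwa [h2] at h1
  by_contra hnone
  push Not at hnone
  -- every |S| ≤ d has small correlation; the others have c_S = 0
  have hlt : (∑ S : Finset (Fin k), c S * corr φ P S) < τ := by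
    have hbound : ∀ S : Finset (Fin k), c S * corr φ P S ≤ |c S| * (τ / L) := by
      intro S
      by_cases hS : d < S.card
      · simp [hc0 S hS]
      · push Not at hS
        calc c S * corr φ P S ≤ |c S * corr φ P S| := le_abs_self _
          _ = |c S| * |corr φ P S| := abs_mul _ _
          _ ≤ |c S| * (τ / L) := mul_le_mul_of_nonneg_left (le_of_lt (hnone S hS)) (abs_nonneg _)
    -- strictness at a set with c_S ≠ 0 (which has |S| ≤ d)
    obtain ⟨S₀, hS₀⟩ : ∃ S, c S ≠ 0 := by
      by_contra hall
      push Not at hall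
      have : L = 0 := by simp [hL, hall]
      exact absurd this (ne_of_gt hLpos)
    have hS₀d : S₀.card ≤ d := by
      by_contra h'
      exact hS₀ (hc0 S₀ (not_le.1 h'))
    have hstrict : c S₀ * corr φ P S₀ < |c S₀| * (τ / L) := by
      calc c S₀ * corr φ P S₀ ≤ |c S₀ * corr φ P S₀| := le_abs_self _
        _ = |c S₀| * |corr φ P S₀| := abs_mul _ _
        _ < |c S₀| * (τ / L) := mul_lt_mul_of_pos_left (hnone S₀ hS₀d) (abs_pos.2 hS₀)
    calc (∑ S : Finset (Fin k), c S * corr φ P S) < ∑ S : Finset (Fin k), |c S| * (τ / L) :=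
          Finset.sum_lt_sum (fun S _ => hbound S) ⟨S₀, Finset.mem_univ _, hstrict⟩
      _ = L * (τ / L) := by rw [← Finset.sum_mul]
      _ = τ := mul_div_cancel₀ τ (ne_of_gt hLpos)
  exact absurd (lt_of_le_of_lt hkey hlt) (lt_irrefl τ)

/-! ### The converse: strong degree `> d` gives a `d`-fooling distribution (ABFR duality via Farkas) -/

section Duality

variable {d : ℕ} {P : (Fin k → Bool) → Bool}

/-- The sets of size `≤ d`, as an index type. [cite: AspnesEtAl1994, §2] -/
abbrev LowSet (k d : ℕ) := {S : Finset (Fin k) // S.card ≤ d}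

/-- Margin normalisation: sign-degree `≤ d` iff some polynomial on the low sets has
`P·g ≥ 1` pointwise (scale a strict representation by its minimum margin over the finite cube).
[cite: AspnesEtAl1994, §2] -/
theorem signDegLE_iff_exists_margin_one :
    SignDegLE d P ↔ ∃ c : LowSet k d → ℚ, ∀ u, 1 ≤ bsgn (P u) * ∑ S : LowSet k d, c S * chiQ S.1 u := by
  classical
  constructor
  · rintro ⟨c, hc0, hpos⟩
    have hne : (Finset.univ : Finset (Fin k → Bool)).Nonempty := Finset.univ_nonempty
    set τ : ℚ := Finset.univ.inf' hne (fun u => bsgn (P u) * ∑ S : Finset (Fin k), c S * chiQ S u)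
      with hτ
    have hτpos : 0 < τ := by
      rw [hτ, Finset.lt_inf'_iff]; intro u _; exact hpos u
    have hτle : ∀ u, τ ≤ bsgn (P u) * ∑ S : Finset (Fin k), c S * chiQ S u :=
      fun u => Finset.inf'_le _ (Finset.mem_univ u)
    refine ⟨fun S => c S.1 / τ, fun u => ?_⟩
    -- the sum over low sets equals the sum over all sets (high coefficients vanish)
    have hsum : (∑ S : LowSet k d, c S.1 / τ * chiQ S.1 u) =
        (∑ S : Finset (Fin k), c S * chiQ S u) / τ := by
      rw [Finset.sum_div]
      have h1 : (∑ S : Finset (Fin k), c S * chiQ S u / τ) =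
          ∑ S ∈ (Finset.univ : Finset (Finset (Fin k))).filter (fun S => S.card ≤ d), c S * chiQ S u / τ := by
        rw [Finset.sum_filter]
        refine Finset.sum_congr rfl fun S _ => ?_
        by_cases h : S.card ≤ d
        · simp [h]
        · simp [h, hc0 S (not_le.1 h)]
      rw [h1, Finset.sum_subtype (p := fun S : Finset (Fin k) => S.card ≤ d)
        ((Finset.univ : Finset (Finset (Fin k))).filter (fun S => S.card ≤ d)) (by intro S; simp)]
      refine Finset.sum_congr rfl fun S _ => ?_
      ring
    rw [hsum, mul_div_assoc']
    exact (one_le_div hτpos).2 (hτle u)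
  · rintro ⟨c, hc⟩
    refine ⟨fun S => if h : S.card ≤ d then c ⟨S, h⟩ else 0, fun S hS => by simp [not_le.2 hS], fun u => ?_⟩
    have hsum : (∑ S : Finset (Fin k), (if h : S.card ≤ d then c ⟨S, h⟩ else 0) * chiQ S u) =
        ∑ S : LowSet k d, c S * chiQ S.1 u := by
      have h1 : (∑ S : Finset (Fin k), (if h : S.card ≤ d then c ⟨S, h⟩ else 0) * chiQ S u) =
          ∑ S ∈ (Finset.univ : Finset (Finset (Fin k))).filter (fun S => S.card ≤ d),
            (if h : S.card ≤ d then c ⟨S, h⟩ else 0) * chiQ S u := by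
        rw [Finset.sum_filter]
        refine Finset.sum_congr rfl fun S _ => ?_
        by_cases h : S.card ≤ d <;> simp [h]
      rw [h1, Finset.sum_subtype (p := fun S : Finset (Fin k) => S.card ≤ d)
        ((Finset.univ : Finset (Finset (Fin k))).filter (fun S => S.card ≤ d)) (by intro S; simp)]
      refine Finset.sum_congr rfl fun S _ => ?_
      simp [S.2]
    rw [hsum]
    exact lt_of_lt_of_le zero_lt_one (hc u)

/-- **The duality for strong degree** (Aspnes–Beigel–Furst–Rudich): if `P` has NO degree-`d` strict
sign-representation then some probability distribution `φ` on the cube makes `P` orthogonal to every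
character of degree `≤ d` (`E_φ[P·χ_S] = 0` for all `|S| ≤ d` — a "`d`-fooling" distribution; for
`d = 2`, equal moments up to order two on `P⁻¹(0)` and `P⁻¹(1)`).  Farkas' lemma (Schrijver Cor. 7.1e,
`Literature.Combinatorics.Optimization.farkas`) applied to the system `P(u)·g(u) ≥ 1`.
[cite: AspnesEtAl1994, §2] [cite: Schrijver1986, Cor. 7.1e] -/
theorem exists_fooling_of_not_signDegLE (h : ¬ SignDegLE d P) :
    ∃ φ : CubeDist k, ∀ S : Finset (Fin k), S.card ≤ d → corr φ P S = 0 := by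
  classical
  rcases Literature.Combinatorics.Optimization.farkas
      (fun (u : Fin k → Bool) (S : LowSet k d) => -(bsgn (P u) * chiQ S.1 u)) (fun _ => (-1 : ℚ)) with
    ⟨x, hx⟩ | ⟨y, hy, hyA, hyb⟩
  · -- a solution of the system is a margin-one representation: contradiction
    refine absurd (signDegLE_iff_exists_margin_one.2 ⟨x, fun u => ?_⟩) h
    have := hx u
    have hrw : (∑ S : LowSet k d, -(bsgn (P u) * chiQ S.1 u) * x S) =
        -(bsgn (P u) * ∑ S : LowSet k d, x S * chiQ S.1 u) := by
      rw [Finset.mul_sum, ← Finset.sum_neg_distrib]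
      refine Finset.sum_congr rfl fun S _ => ?_
      ring
    rw [hrw] at this
    linarith
  · -- a Farkas multiplier, normalised, is the fooling distribution
    have hY : 0 < ∑ u, y u := by
      have : (∑ u, y u * (-1 : ℚ)) = -(∑ u, y u) := by
        rw [← Finset.sum_neg_distrib]; exact Finset.sum_congr rfl fun u _ => by ring
      rw [this] at hyb
      linarith
    refine ⟨⟨fun u => y u / ∑ v, y v, fun u => div_nonneg (hy u) hY.le, ?_⟩, fun S hS => ?_⟩
    · rw [← Finset.sum_div]
      exact div_self (ne_of_gt hY)
    · have h0 := hyA ⟨S, hS⟩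
      -- Σ_u y_u · (−P(u)χ_S(u)) = 0  ⇒  corr = 0
      unfold corr
      have : (∑ u, y u / (∑ v, y v) * (bsgn (P u) * chiQ S u)) =
          -(∑ u, y u * -(bsgn (P u) * chiQ S u)) / ∑ v, y v := by
        rw [← Finset.sum_neg_distrib, Finset.sum_div]
        refine Finset.sum_congr rfl fun u _ => ?_
        ring
      rw [this, h0, neg_zero, zero_div]

/-- Strong degree `> d` defeats `(d, δ)`-simplicity for every `δ > 0`. [cite: AspnesEtAl1994, §2]
[cite: GuruswamiLyuWang2025, Def. 32] -/
theorem not_isSimple_of_not_signDegLE (h : ¬ SignDegLE d P) {δ : ℚ} (hδ : 0 < δ) : ¬ IsSimple d δ P := by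
  intro hs
  obtain ⟨φ, hφ⟩ := exists_fooling_of_not_signDegLE h
  obtain ⟨S, hS, hc⟩ := hs φ
  rw [hφ S hS, abs_zero] at hc
  exact absurd hc (not_le.2 hδ)

/-- **Sign-degree `≤ d` ⟺ `(d, δ)`-simple for some `δ > 0`**: Guruswami–Lyu–Wang's simplicity
measure (Def. 32) IS bounded strong degree (ABFR), by LP duality. [cite: AspnesEtAl1994, §2]
[cite: GuruswamiLyuWang2025, Def. 32] -/
theorem signDegLE_iff_exists_isSimple : SignDegLE d P ↔ ∃ δ : ℚ, 0 < δ ∧ IsSimple d δ P := by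
  constructor
  · exact exists_isSimple_of_signDegLE
  · rintro ⟨δ, hδ, hs⟩
    by_contra h
    exact not_isSimple_of_not_signDegLE h hδ hs

end Duality

end Literature.Computability.Complexity
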